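import Summits.RiemannHypothesis.RiemannHypothesis.Theorems.Splittings.ScrewBridgeFozConsequences
import Summits.RiemannHypothesis.RiemannHypothesis.Theorems.Splittings.ScrewBridgeWeakTail
import Summits.RiemannHypothesis.RiemannHypothesis.Theorems.Splittings.ScrewNullCombinationFoz
import HarnessLib

/-!
# Splittings — SCREW BRIDGE g5 (part b): R3 residual shrunk from `LIM` to `LIM-b` (bookkeeping)

Cell rh-split (brief sha16 f79c5f09d8bcb036), seat rh-split-screw-bridge g5, card §10-T of
`run/shared/lean/pub/rh-split/cards/SPLIT-screw-bridge.md`.  Companion to `ScrewBridgeG5.lean`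
(c26d31e4e9941ae1, carved by typer-2 g3).  Zero defs; RH nowhere.

The g5 paper THEOREM A⁺ (card §10-T) improves THEOREM A (§10 R10.3): atomic mean-zero witnesses with
negative definite kernel Gram exist for every finite set of «top» off-line quadruples (those exceeded in
distance from the line by only finitely many others), unconditionally; hence `U_quad` holds unless the
off-line distances are in configuration

* `LIMB` := `∃ x > 0`, only finitely many non-trivial zeros have `|Re ρ − ½| ≥ x`, but for every `ε > 0`
  infinitely many have `|Re ρ − ½| > x − ε` (the eventual supremum `x` of the off-line distances is attained
  by NO infinite family) — a sub-configuration of §6's `LIM` (which had `>` in the finiteness clause).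

This file records the bookkeeping with `LIM` replaced by `LIMB`: `limb_imp_lim`, `ola_not_limb`,
`foz_or_limb_of_indexBounded (hA : ¬LIMB → U_quad) : IndexBounded → FOZ ∨ LIMB`,
`etail_imp_foz_or_limb`, `etail_iff_foz_of_not_limb`, `etail_iff_foz_of_thmAplus_of_ola`.
`U_quad` is, verbatim, the hypothesis `hU` of the tree's `ScrewBridgeWeakTail.indexTransfer_of_indexLowerBoundQuad`;
`ETAIL`/`FOZ`/`IndexBounded` literals as in `ScrewBridgeRawG3`.  [folklore bookkeeping; the content is the
paper theorem entering as `hA`]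
-/

set_option linter.dupNamespace false

noncomputable section

namespace Summit.RiemannHypothesis.RiemannHypothesis.Theorems.Splittings.ScrewBridgeG5b

open Filter Topology Finset Complex
open Literature.NumberTheory.LFunctions
open Summit.RiemannHypothesis.RiemannHypothesis.Theses.RuelleBand
open Summit.RiemannHypothesis.RiemannHypothesis.Theorems.IntegerScrew

/-- `LIMB ⟹ LIM` (the `≥ x`-finite configuration is a special case of the `> x`-finite one). [folklore] -/
theorem limb_imp_lim
    (h : ∃ x : ℝ, 0 < x ∧
        Set.Finite {ρ : ℂ | ρ ∈ ZetaZeros.riemannZetaNontrivialZeros ∧ x ≤ |ρ.re - 1 / 2|} ∧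
        ∀ ε : ℝ, 0 < ε →
          Set.Infinite {ρ : ℂ | ρ ∈ ZetaZeros.riemannZetaNontrivialZeros ∧ x - ε < |ρ.re - 1 / 2|}) :
    ∃ x : ℝ, 0 < x ∧
        Set.Finite {ρ : ℂ | ρ ∈ ZetaZeros.riemannZetaNontrivialZeros ∧ x < |ρ.re - 1 / 2|} ∧
        ∀ ε : ℝ, 0 < ε →
          Set.Infinite {ρ : ℂ | ρ ∈ ZetaZeros.riemannZetaNontrivialZeros ∧ x - ε < |ρ.re - 1 / 2|} := by
  obtain ⟨x, hx, hfin, hinf⟩ := h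
  refine ⟨x, hx, hfin.subset ?_, hinf⟩
  rintro ρ ⟨hρ, hlt⟩
  exact ⟨hρ, hlt.le⟩

/-- `OLA` excludes `LIMB`. [folklore] -/
theorem ola_not_limb
    (hola : ∀ η : ℝ, 0 < η →
      Set.Finite {ρ : ℂ | ρ ∈ ZetaZeros.riemannZetaNontrivialZeros ∧ η ≤ |ρ.re - 1 / 2|}) :
    ¬ (∃ x : ℝ, 0 < x ∧
        Set.Finite {ρ : ℂ | ρ ∈ ZetaZeros.riemannZetaNontrivialZeros ∧ x ≤ |ρ.re - 1 / 2|} ∧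
        ∀ ε : ℝ, 0 < ε →
          Set.Infinite {ρ : ℂ | ρ ∈ ZetaZeros.riemannZetaNontrivialZeros ∧ x - ε < |ρ.re - 1 / 2|}) := by
  rintro ⟨x, hx, -, hinf⟩
  refine hinf (x / 2) (by positivity) ((hola (x / 2) (by positivity)).subset ?_)
  rintro ρ ⟨hρ, hlt⟩
  exact ⟨hρ, by linarith⟩

/-- **R3 after g5 (A⁺ bookkeeping).** Given the paper theorem `hA : ¬LIMB → U_quad`, a bounded negative index
of the screw matrices forces `FOZ ∨ LIMB` (tree `indexTransfer_of_indexLowerBoundQuad`). [folklore] -/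
theorem foz_or_limb_of_indexBounded
    (hA : ¬ (∃ x : ℝ, 0 < x ∧
        Set.Finite {ρ : ℂ | ρ ∈ ZetaZeros.riemannZetaNontrivialZeros ∧ x ≤ |ρ.re - 1 / 2|} ∧
        ∀ ε : ℝ, 0 < ε →
          Set.Infinite {ρ : ℂ | ρ ∈ ZetaZeros.riemannZetaNontrivialZeros ∧ x - ε < |ρ.re - 1 / 2|}) →
      ∀ F : Finset ZetaZeros.riemannZetaNontrivialZeros,
        (∀ ρ ∈ F, 1 / 2 < (ρ : ℂ).re ∧ 0 < (ρ : ℂ).im) →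
          ∃ N : ℕ, ∀ n : ℕ, N ≤ n →
            F.card ≤ (Finset.univ.filter fun i => (screwMatrix_isHermitian n).eigenvalues i < 0).card)
    (hidx : ∃ K : ℕ, ∀ n : ℕ,
      (Finset.univ.filter fun i => (screwMatrix_isHermitian n).eigenvalues i < 0).card ≤ K) :
    CofiniteCriticalLine ∨
      (∃ x : ℝ, 0 < x ∧
        Set.Finite {ρ : ℂ | ρ ∈ ZetaZeros.riemannZetaNontrivialZeros ∧ x ≤ |ρ.re - 1 / 2|} ∧
        ∀ ε : ℝ, 0 < ε →
          Set.Infinite {ρ : ℂ | ρ ∈ ZetaZeros.riemannZetaNontrivialZeros ∧ x - ε < |ρ.re - 1 / 2|}) := by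
  by_cases hlim : (∃ x : ℝ, 0 < x ∧
      Set.Finite {ρ : ℂ | ρ ∈ ZetaZeros.riemannZetaNontrivialZeros ∧ x ≤ |ρ.re - 1 / 2|} ∧
      ∀ ε : ℝ, 0 < ε →
        Set.Infinite {ρ : ℂ | ρ ∈ ZetaZeros.riemannZetaNontrivialZeros ∧ x - ε < |ρ.re - 1 / 2|})
  · exact Or.inr hlim
  · exact Or.inl (ScrewBridgeWeakTail.indexTransfer_of_indexLowerBoundQuad (hA hlim) hidx)

/-- `ETAIL ⟹ FOZ ∨ LIMB`, given the paper theorem `hA : ¬LIMB → U_quad` (through the tree's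
`ScrewBridgeRawG3.etail_boundedIndex`). [folklore] -/
theorem etail_imp_foz_or_limb
    (hA : ¬ (∃ x : ℝ, 0 < x ∧
        Set.Finite {ρ : ℂ | ρ ∈ ZetaZeros.riemannZetaNontrivialZeros ∧ x ≤ |ρ.re - 1 / 2|} ∧
        ∀ ε : ℝ, 0 < ε →
          Set.Infinite {ρ : ℂ | ρ ∈ ZetaZeros.riemannZetaNontrivialZeros ∧ x - ε < |ρ.re - 1 / 2|}) →
      ∀ F : Finset ZetaZeros.riemannZetaNontrivialZeros,
        (∀ ρ ∈ F, 1 / 2 < (ρ : ℂ).re ∧ 0 < (ρ : ℂ).im) →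
          ∃ N : ℕ, ∀ n : ℕ, N ≤ n →
            F.card ≤ (Finset.univ.filter fun i => (screwMatrix_isHermitian n).eigenvalues i < 0).card)
    (het : ∃ M₀ : ℕ, ∀ M : ℕ, M₀ ≤ M → 0 < screwPivot M) :
    CofiniteCriticalLine ∨
      (∃ x : ℝ, 0 < x ∧
        Set.Finite {ρ : ℂ | ρ ∈ ZetaZeros.riemannZetaNontrivialZeros ∧ x ≤ |ρ.re - 1 / 2|} ∧
        ∀ ε : ℝ, 0 < ε →
          Set.Infinite {ρ : ℂ | ρ ∈ ZetaZeros.riemannZetaNontrivialZeros ∧ x - ε < |ρ.re - 1 / 2|}) :=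
  foz_or_limb_of_indexBounded hA (ScrewBridgeRawG3.etail_boundedIndex het)

/-- **T2 outside `LIMB` (kernel bookkeeping):** given the paper theorem `hA : ¬LIMB → U_quad`, in every zero
configuration other than `LIMB` the cell's T2 holds: `ETAIL ⟺ FOZ` (`FOZ ⟹ ETAIL` is typer-2's tree
`ScrewNullComb.etail_of_foz`). [folklore] -/
theorem etail_iff_foz_of_not_limb
    (hA : ¬ (∃ x : ℝ, 0 < x ∧
        Set.Finite {ρ : ℂ | ρ ∈ ZetaZeros.riemannZetaNontrivialZeros ∧ x ≤ |ρ.re - 1 / 2|} ∧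
        ∀ ε : ℝ, 0 < ε →
          Set.Infinite {ρ : ℂ | ρ ∈ ZetaZeros.riemannZetaNontrivialZeros ∧ x - ε < |ρ.re - 1 / 2|}) →
      ∀ F : Finset ZetaZeros.riemannZetaNontrivialZeros,
        (∀ ρ ∈ F, 1 / 2 < (ρ : ℂ).re ∧ 0 < (ρ : ℂ).im) →
          ∃ N : ℕ, ∀ n : ℕ, N ≤ n →
            F.card ≤ (Finset.univ.filter fun i => (screwMatrix_isHermitian n).eigenvalues i < 0).card)
    (hnot : ¬ (∃ x : ℝ, 0 < x ∧
        Set.Finite {ρ : ℂ | ρ ∈ ZetaZeros.riemannZetaNontrivialZeros ∧ x ≤ |ρ.re - 1 / 2|} ∧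
        ∀ ε : ℝ, 0 < ε →
          Set.Infinite {ρ : ℂ | ρ ∈ ZetaZeros.riemannZetaNontrivialZeros ∧ x - ε < |ρ.re - 1 / 2|})) :
    (∃ M₀ : ℕ, ∀ M : ℕ, M₀ ≤ M → 0 < screwPivot M) ↔ CofiniteCriticalLine :=
  ⟨fun het => (etail_imp_foz_or_limb hA het).resolve_right hnot,
    fun hfoz => ScrewNullComb.etail_of_foz hfoz⟩

/-- **T2 under `OLA` (A⁺ version).** [folklore] -/
theorem etail_iff_foz_of_thmAplus_of_ola
    (hA : ¬ (∃ x : ℝ, 0 < x ∧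
        Set.Finite {ρ : ℂ | ρ ∈ ZetaZeros.riemannZetaNontrivialZeros ∧ x ≤ |ρ.re - 1 / 2|} ∧
        ∀ ε : ℝ, 0 < ε →
          Set.Infinite {ρ : ℂ | ρ ∈ ZetaZeros.riemannZetaNontrivialZeros ∧ x - ε < |ρ.re - 1 / 2|}) →
      ∀ F : Finset ZetaZeros.riemannZetaNontrivialZeros,
        (∀ ρ ∈ F, 1 / 2 < (ρ : ℂ).re ∧ 0 < (ρ : ℂ).im) →
          ∃ N : ℕ, ∀ n : ℕ, N ≤ n →
            F.card ≤ (Finset.univ.filter fun i => (screwMatrix_isHermitian n).eigenvalues i < 0).card)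
    (hola : ∀ η : ℝ, 0 < η →
      Set.Finite {ρ : ℂ | ρ ∈ ZetaZeros.riemannZetaNontrivialZeros ∧ η ≤ |ρ.re - 1 / 2|}) :
    (∃ M₀ : ℕ, ∀ M : ℕ, M₀ ≤ M → 0 < screwPivot M) ↔ CofiniteCriticalLine :=
  etail_iff_foz_of_not_limb hA (ola_not_limb hola)

end Summit.RiemannHypothesis.RiemannHypothesis.Theorems.Splittings.ScrewBridgeG5b
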